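import Summits.CriticalPhenomena.PercolationContinuityZ3.Theorems.PercNearOneGluingNoHeavyLowerTailKnQuestion8CoefficientwiseCoreClassKernelMixHubMinSide
import HarnessLib

/-!
# The max-side matching μ₂ of the augmented staircase theorem, by parts (PATH LEMMA of hub-Kleitman, layer 2')

Support file (`--supports stmt-CriticalPhenomena-4575`, closed), prover `prim-cplus-coupling` (gen 51).  No definitions, no notations,
no named facts, no sorries; standard axioms.  Memo `prim-cplus-coupling/A5-COUPLING-gen51.md` §2 (Lemma 2.4 = mirror of 2.3).

Mirror image of `…KernelMixHubMinSide`: the max-side map μ₂ ('toggle `t₂ X`') of the augmented staircase theorem is an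
involution on
* `hubStair_mu2_innerPart` — inner sets `X ⊆ [1,N-1]` whose cell lies in the staircase `R` (column `x` of `R` is `[x, om x]`)
  but not in the up-closed cell set `B` (column `x` of `B` is `[betaP x, N-1]`), together with `∅` when `bd = db + 1`: toggle
  `θ₂ (min X)`, `θ₂ x = min (om x) (betaP x - 1)` (`∅ ↦ {db}`);
* `hubStair_mu2_bottomPart` — sets `{0} ∪ Z` with cell(Z) in the down-closed cell set `A` (column `x` of `A` is
  `[x, alphaP x]`), together with `{0}` when `sA = dA + 1`: toggle `alphaP (min Z)` (`{0} ↦ {0, sA}`).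
Both are instances of `maxToggle_invol` (…KernelMixHubToggle).
[cite: KozmaNitzan2024, Questions 8–9 (§5.5 p. 36) (context)]
-/

namespace Summit.CriticalPhenomena.PercolationContinuityZ3.Theorems

open Finset
open scoped symmDiff

namespace Coefficientwise

/-- **Fixed points of the column threshold θ₂.**  With column `x` of `B` equal to `[betaP x, N-1]` (up-closed `B` with
diagonal start `bd` and domino start `db`, `db ≤ bd ≤ db+1`, `db ≤ N-1`, `bd ≤ N`) and `x + 1 ≤ om x`:
`min (om x) (betaP x - 1) = x` iff `bd = db + 1` and `x = db`. [folklore] -/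
theorem hubStair_theta2_fix (N : ℕ) (om betaP : ℕ → ℕ) (bd db : ℕ) (B : Finset (ℕ × ℕ))
    (hom : ∀ x, 1 ≤ x → x ≤ N - 1 → x + 1 ≤ om x)
    (hBcol : ∀ x y, (x, y) ∈ B ↔ 1 ≤ x ∧ x ≤ y ∧ y ≤ N - 1 ∧ betaP x ≤ y)
    (hBdiag : ∀ x, (x, x) ∈ B ↔ 1 ≤ x ∧ bd ≤ x ∧ x ≤ N - 1)
    (hBdom : ∀ x, (x, x + 1) ∈ B ↔ 1 ≤ x ∧ db ≤ x ∧ x + 1 ≤ N - 1)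
    (hbd : db ≤ bd ∧ bd ≤ db + 1) (hdbN : db ≤ N - 1) (hbdN : bd ≤ N)
    (hbetaP : ∀ x, 1 ≤ x → x ≤ N - 1 → x ≤ betaP x ∧ betaP x ≤ N)
    (x : ℕ) (hx1 : 1 ≤ x) (hxN : x ≤ N - 1) :
    min (om x) (betaP x - 1) = x ↔ (bd = db + 1 ∧ x = db) := by
  have ho := hom x hx1 hxN
  have hbP := hbetaP x hx1 hxN
  have hdiag : (betaP x ≤ x) ↔ (1 ≤ x ∧ bd ≤ x ∧ x ≤ N - 1) := by
    rw [← hBdiag, hBcol]; omega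
  by_cases hx2 : x + 1 ≤ N - 1
  · have hdom : (betaP x ≤ x + 1) ↔ (1 ≤ x ∧ db ≤ x ∧ x + 1 ≤ N - 1) := by
      rw [← hBdom x, hBcol]; omega
    constructor
    · intro h
      have h1 : betaP x = x + 1 := by omega
      have h2 : betaP x ≤ x + 1 := le_of_eq h1
      rw [hdom] at h2
      have h3 : ¬ (betaP x ≤ x) := by omega
      rw [hdiag] at h3
      omega
    · rintro ⟨hb, hxd⟩
      have h2 : betaP x ≤ x + 1 := hdom.mpr ⟨hx1, by omega, hx2⟩
      have h3 : ¬ (betaP x ≤ x) := by rw [hdiag]; omega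
      omega
  · have hx : x = N - 1 := by omega
    constructor
    · intro h
      have h3 : ¬ (betaP x ≤ x) := by omega
      rw [hdiag] at h3
      omega
    · rintro ⟨hb, hxdb⟩
      have h3 : ¬ (betaP x ≤ x) := by rw [hdiag]; omega
      omega

/-- **μ₂ on the inner part** (inner sets with cell in `R ∖ B`, plus `∅` iff `bd = db + 1`): toggling `θ₂ (min X)`
(`db` for `∅`) preserves the part, returns the same toggled element, and toggles an element `≥ max X`. [folklore] -/
theorem hubStair_mu2_innerPart (N : ℕ) (om betaP : ℕ → ℕ) (bd db : ℕ) (B : Finset (ℕ × ℕ))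
    (hom : ∀ x, 1 ≤ x → x ≤ N - 1 → x + 1 ≤ om x ∧ om x ≤ N)
    (hBcol : ∀ x y, (x, y) ∈ B ↔ 1 ≤ x ∧ x ≤ y ∧ y ≤ N - 1 ∧ betaP x ≤ y)
    (hBdiag : ∀ x, (x, x) ∈ B ↔ 1 ≤ x ∧ bd ≤ x ∧ x ≤ N - 1)
    (hBdom : ∀ x, (x, x + 1) ∈ B ↔ 1 ≤ x ∧ db ≤ x ∧ x + 1 ≤ N - 1)
    (hbd : db ≤ bd ∧ bd ≤ db + 1) (hdb1 : 1 ≤ db) (hdbN : db ≤ N - 1) (hbdN : bd ≤ N)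
    (hbetaP : ∀ x, 1 ≤ x → x ≤ N - 1 → x ≤ betaP x ∧ betaP x ≤ N)
    (b : Finset ℕ → ℕ)
    (hb : ∀ X : Finset ℕ, b X = if h : X.Nonempty then min (om (X.min' h)) (betaP (X.min' h) - 1) else db)
    (X : Finset ℕ)
    (hX : (X = ∅ ∧ bd = db + 1) ∨
      (X.Nonempty ∧ (∀ e ∈ X, 1 ≤ e ∧ e ≤ N - 1) ∧
        ∀ h : X.Nonempty, X.max' h ≤ min (om (X.min' h)) (betaP (X.min' h) - 1))) :
    ((X ∆ {b X} = ∅ ∧ bd = db + 1) ∨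
      ((X ∆ {b X}).Nonempty ∧ (∀ e ∈ X ∆ {b X}, 1 ≤ e ∧ e ≤ N - 1) ∧
        ∀ h : (X ∆ {b X}).Nonempty,
          (X ∆ {b X}).max' h ≤ min (om ((X ∆ {b X}).min' h)) (betaP ((X ∆ {b X}).min' h) - 1))) ∧
    b (X ∆ {b X}) = b X ∧ ∀ e ∈ X, e ≤ b X := by
  classical
  obtain ⟨θ, hθ⟩ : ∃ θ : ℕ → ℕ, ∀ x, θ x = min (om x) (betaP x - 1) := ⟨_, fun _ => rfl⟩
  have hθfix : ∀ x, 1 ≤ x → x ≤ N - 1 → (θ x = x ↔ (bd = db + 1 ∧ x = db)) := by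
    intro x hx1 hxN
    rw [hθ]
    exact hubStair_theta2_fix N om betaP bd db B (fun x h1 h2 => (hom x h1 h2).1) hBcol hBdiag hBdom hbd hdbN hbdN
      hbetaP x hx1 hxN
  have hθle : ∀ x, 1 ≤ x → x ≤ N - 1 → θ x ≤ N - 1 := by
    intro x hx1 hxN
    rw [hθ]
    have := (hbetaP x hx1 hxN).2
    have := (hom x hx1 hxN).2
    omega
  set I : Finset ℕ := (Finset.Icc 1 (N - 1)).filter (fun m => m ≤ θ m) with hIdef
  have hIiff : ∀ m, m ∈ I ↔ 1 ≤ m ∧ m ≤ N - 1 ∧ m ≤ θ m := by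
    intro m; rw [hIdef, mem_filter, mem_Icc]; tauto
  have hbθ : ∀ Y : Finset ℕ, b Y = if h : Y.Nonempty then θ (Y.min' h) else db := by
    intro Y; rw [hb]; split_ifs <;> simp [hθ]
  have hK_of : ∀ Y : Finset ℕ,
      ((Y = ∅ ∧ bd = db + 1) ∨ (Y.Nonempty ∧ (∀ e ∈ Y, 1 ≤ e ∧ e ≤ N - 1) ∧
        ∀ h : Y.Nonempty, Y.max' h ≤ min (om (Y.min' h)) (betaP (Y.min' h) - 1))) ↔
      ((Y = ∅ ∧ ∃ m ∈ I, θ m = m) ∨ (∃ h : Y.Nonempty, Y.min' h ∈ I ∧ ∀ e ∈ Y, e ≤ θ (Y.min' h))) := by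
    intro Y
    constructor
    · rintro (⟨rfl, hs⟩ | ⟨hne, hbd', hθ'⟩)
      · left; refine ⟨rfl, db, ?_, ?_⟩
        · rw [hIiff]
          have := (hθfix db hdb1 hdbN).mpr ⟨hs, rfl⟩
          exact ⟨hdb1, hdbN, ge_of_eq this⟩
        · exact (hθfix db hdb1 hdbN).mpr ⟨hs, rfl⟩
      · right; refine ⟨hne, ?_, ?_⟩
        · rw [hIiff]
          have hm := hbd' _ (min'_mem Y hne)
          refine ⟨hm.1, hm.2, ?_⟩
          have := hθ' hne
          rw [← hθ] at this
          exact (le_max' Y _ (min'_mem Y hne)).trans this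
        · intro e he
          have := hθ' hne
          rw [← hθ] at this
          exact (le_max' Y e he).trans this
    · rintro (⟨rfl, m, hmI, hmfix⟩ | ⟨hne, hmI, hup⟩)
      · left
        rw [hIiff] at hmI
        exact ⟨rfl, ((hθfix m hmI.1 hmI.2.1).mp hmfix).1⟩
      · right
        rw [hIiff] at hmI
        refine ⟨hne, ?_, fun h => ?_⟩
        · intro e he
          have h1 := hup e he
          have h2 : Y.min' hne ≤ e := min'_le Y e he
          have h3 : θ (Y.min' hne) ≤ N - 1 := hθle _ hmI.1 hmI.2.1
          omega
        · rw [← hθ]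
          exact max'_le Y hne _ hup
  have hgen := maxToggle_invol I θ db
    (fun m hm => ((hIiff m).mp hm).2.2)
    (fun m hm m' hm' h1 h2 => by
      rw [hIiff] at hm hm'
      have e1 := ((hθfix m hm.1 hm.2.1).mp h1).2
      have e2 := ((hθfix m' hm'.1 hm'.2.1).mp h2).2
      omega)
    (fun ⟨m, hm, hfix⟩ => by
      rw [hIiff] at hm
      have hs := ((hθfix m hm.1 hm.2.1).mp hfix).1
      have hf : θ db = db := (hθfix db hdb1 hdbN).mpr ⟨hs, rfl⟩
      exact ⟨(hIiff _).mpr ⟨hdb1, hdbN, ge_of_eq hf⟩, hf⟩)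
    b hbθ X ((hK_of X).mp hX)
  obtain ⟨h1, h2, h3⟩ := hgen
  exact ⟨(hK_of _).mpr h1, h2, h3⟩

/-- **μ₂ on the bottom part** (sets `{0} ∪ Z` with cell(Z) ∈ `A`, plus `{0}` iff `sA = dA + 1`): toggling
`alphaP (min Z)` (`sA` for `{0}`) preserves the part, returns the same toggled element, and toggles an element
`≥ max`. [folklore] -/
theorem hubStair_mu2_bottomPart (N : ℕ) (alphaP : ℕ → ℕ) (sA dA : ℕ) (A : Finset (ℕ × ℕ))
    (hAcol : ∀ x y, (x, y) ∈ A ↔ 1 ≤ x ∧ x ≤ y ∧ y ≤ N - 1 ∧ y ≤ alphaP x)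
    (hAdiag : ∀ x, (x, x) ∈ A ↔ 1 ≤ x ∧ x ≤ sA)
    (hAdom : ∀ x, (x, x + 1) ∈ A ↔ 1 ≤ x ∧ x ≤ dA)
    (hsd : dA ≤ sA ∧ sA ≤ dA + 1) (hsN : sA ≤ N - 1)
    (halphaP : ∀ x, alphaP x ≤ N - 1)
    (c : Finset ℕ → ℕ)
    (hc : ∀ X : Finset ℕ, c X = if h : (X.erase 0).Nonempty then alphaP ((X.erase 0).min' h) else sA)
    (X : Finset ℕ)
    (hX : 0 ∈ X ∧ (∀ e ∈ X, e ≤ N - 1) ∧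
      ((X = {0} ∧ sA = dA + 1) ∨ ∃ h : (X.erase 0).Nonempty, ((X.erase 0).min' h, (X.erase 0).max' h) ∈ A)) :
    (0 ∈ X ∆ {c X} ∧ (∀ e ∈ X ∆ {c X}, e ≤ N - 1) ∧
      ((X ∆ {c X} = {0} ∧ sA = dA + 1) ∨
        ∃ h : ((X ∆ {c X}).erase 0).Nonempty, (((X ∆ {c X}).erase 0).min' h, ((X ∆ {c X}).erase 0).max' h) ∈ A)) ∧
    c (X ∆ {c X}) = c X ∧ ∀ e ∈ X, e ≤ c X := by
  classical
  obtain ⟨h0X, hle, hrest⟩ := hX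
  set Z := X.erase 0 with hZdef
  -- diagonal fixed points of alphaP: alphaP x = x iff (sA = dA + 1 ∧ x = sA), for diagonal cells (x,x) ∈ A
  have hαfix : ∀ x, 1 ≤ x → x ≤ N - 1 → x ≤ alphaP x → (alphaP x = x ↔ (sA = dA + 1 ∧ x = sA)) := by
    intro x hx1 hxN hxa
    have hd : (x, x) ∈ A := (hAcol x x).mpr ⟨hx1, le_rfl, hxN, hxa⟩
    have hxs : x ≤ sA := ((hAdiag x).mp hd).2
    have hdom : (x + 1 ≤ alphaP x) ↔ (1 ≤ x ∧ x ≤ dA) := by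
      rw [← hAdom x, hAcol]
      constructor
      · intro h
        exact ⟨hx1, by omega, (halphaP x).trans' h |> fun hh => by omega, h⟩
      · intro h; exact h.2.2.2
    constructor
    · intro h
      have : ¬ (x + 1 ≤ alphaP x) := by omega
      rw [hdom] at this
      omega
    · rintro ⟨h1, h2⟩
      have : ¬ (1 ≤ x ∧ x ≤ dA) := by omega
      rw [← hdom] at this
      omega
  set I : Finset ℕ := (Finset.Icc 1 (N - 1)).filter (fun x => x ≤ alphaP x) with hIdef
  have hIiff : ∀ x, x ∈ I ↔ 1 ≤ x ∧ x ≤ N - 1 ∧ x ≤ alphaP x := by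
    intro x; rw [hIdef, mem_filter, mem_Icc]; tauto
  obtain ⟨a, haY⟩ : ∃ a : Finset ℕ → ℕ, ∀ Y : Finset ℕ, a Y = if h : Y.Nonempty then alphaP (Y.min' h) else sA :=
    ⟨_, fun Y => rfl⟩
  have hfixI : (∃ m ∈ I, alphaP m = m) → sA = dA + 1 := by
    rintro ⟨m, hm, hfix⟩
    rw [hIiff] at hm
    exact ((hαfix m hm.1 hm.2.1 hm.2.2).mp hfix).1
  have hs1_of : sA = dA + 1 → 1 ≤ sA := fun h => by omega
  have hKZ : (Z = ∅ ∧ ∃ m ∈ I, alphaP m = m) ∨ (∃ h : Z.Nonempty, Z.min' h ∈ I ∧ ∀ e ∈ Z, e ≤ alphaP (Z.min' h)) := by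
    rcases hrest with ⟨hX0, hsd'⟩ | ⟨hZne, hcell⟩
    · left
      have hZ : Z = ∅ := by rw [hZdef, hX0]; simp
      have hs1 := hs1_of hsd'
      have hd : (sA, sA) ∈ A := (hAdiag sA).mpr ⟨hs1, le_rfl⟩
      have hsa := ((hAcol sA sA).mp hd).2.2.2
      refine ⟨hZ, sA, ?_, ?_⟩
      · rw [hIiff]; exact ⟨hs1, hsN, hsa⟩
      · exact (hαfix sA hs1 hsN hsa).mpr ⟨hsd', rfl⟩
    · right
      have hA := (hAcol _ _).mp hcell
      refine ⟨hZne, ?_, ?_⟩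
      · rw [hIiff]
        exact ⟨hA.1, (min'_le Z _ (max'_mem Z hZne)).trans hA.2.2.1, hA.2.1.trans hA.2.2.2⟩
      · intro e he
        exact (le_max' Z e he).trans hA.2.2.2
  have hgen := maxToggle_invol I alphaP sA
    (fun m hm => ((hIiff m).mp hm).2.2)
    (fun m hm m' hm' h1 h2 => by
      rw [hIiff] at hm hm'
      have e1 := ((hαfix m hm.1 hm.2.1 hm.2.2).mp h1).2
      have e2 := ((hαfix m' hm'.1 hm'.2.1 hm'.2.2).mp h2).2
      omega)
    (fun hex => by
      have hsd' := hfixI hex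
      have hs1 := hs1_of hsd'
      have hd : (sA, sA) ∈ A := (hAdiag sA).mpr ⟨hs1, le_rfl⟩
      have hsa := ((hAcol sA sA).mp hd).2.2.2
      exact ⟨(hIiff sA).mpr ⟨hs1, hsN, hsa⟩, (hαfix sA hs1 hsN hsa).mpr ⟨hsd', rfl⟩⟩)
    a haY Z hKZ
  obtain ⟨hK', haa, hamax⟩ := hgen
  have hcX : c X = a Z := by rw [hc, haY]
  -- the toggled element is ≥ 1, hence ≠ 0
  have haZ_pos : 1 ≤ a Z := by
    rcases hKZ with ⟨hZ0, m, hm, hmf⟩ | ⟨hZne, hmI, _⟩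
    · have hsd' := hfixI ⟨m, hm, hmf⟩
      have hZn : ¬ Z.Nonempty := by rw [hZ0]; exact Finset.not_nonempty_empty
      rw [haY, dif_neg hZn]
      exact hs1_of hsd'
    · rw [haY, dif_pos hZne]; rw [hIiff] at hmI; exact hmI.1.trans hmI.2.2
  have ha0 : a Z ≠ 0 := Nat.pos_iff_ne_zero.mp haZ_pos
  obtain ⟨hcomm, hmem0⟩ := hub_symmDiff_singleton_erase_comm X (a Z) 0 ha0
  rw [hcX]
  have hZ' : (X ∆ {a Z}).erase 0 = Z ∆ {a Z} := by rw [hcomm]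
  have haZ_le : a Z ≤ N - 1 := by
    rcases hKZ with ⟨hZ0, m, hm, hmf⟩ | ⟨hZne, hmI, _⟩
    · have hZn : ¬ Z.Nonempty := by rw [hZ0]; exact Finset.not_nonempty_empty
      rw [haY, dif_neg hZn]; exact hsN
    · rw [haY, dif_pos hZne]; exact halphaP _
  refine ⟨⟨hmem0.mpr h0X, ?_, ?_⟩, ?_, ?_⟩
  · intro e he
    rw [mem_symmDiff, mem_singleton] at he
    rcases he with ⟨he, _⟩ | ⟨rfl, _⟩
    · exact hle e he
    · exact haZ_le
  · rcases hK' with ⟨hE, hex⟩ | ⟨hne', hmI', hup'⟩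
    · left
      refine ⟨?_, hfixI hex⟩
      ext e
      constructor
      · intro he
        rw [mem_singleton]
        by_contra hne
        have : e ∈ (X ∆ {a Z}).erase 0 := mem_erase.mpr ⟨hne, he⟩
        rw [hZ', hE] at this
        simp at this
      · intro he
        rw [mem_singleton] at he
        rw [he]
        exact hmem0.mpr h0X
    · right
      have hne'' : ((X ∆ {a Z}).erase 0).Nonempty := by rw [hZ']; exact hne'
      refine ⟨hne'', ?_⟩
      have hmax : ((X ∆ {a Z}).erase 0).max' hne'' = (Z ∆ {a Z}).max' hne' := by
        apply le_antisymm
        · apply max'_le; intro e he; rw [hZ'] at he; exact le_max' _ e he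
        · apply max'_le; intro e he; rw [← hZ'] at he; exact le_max' _ e he
      have hmin : ((X ∆ {a Z}).erase 0).min' hne'' = (Z ∆ {a Z}).min' hne' := by
        apply le_antisymm
        · apply le_min'; intro e he; rw [← hZ'] at he; exact min'_le _ e he
        · apply le_min'; intro e he; rw [hZ'] at he; exact min'_le _ e he
      rw [hmax, hmin, hAcol]
      rw [hIiff] at hmI'
      have hupmax : (Z ∆ {a Z}).max' hne' ≤ alphaP ((Z ∆ {a Z}).min' hne') := max'_le _ hne' _ hup'
      exact ⟨hmI'.1, min'_le _ _ (max'_mem _ hne'), (le_max' _ _ (max'_mem _ hne')).trans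
        (hupmax.trans (halphaP _)), hupmax⟩
  · rw [hc, hZ', ← haY]
    exact haa
  · intro e he
    by_cases he0 : e = 0
    · rw [he0]; exact Nat.zero_le _
    · exact hamax e (mem_erase.mpr ⟨he0, he⟩)

end Coefficientwise

end Summit.CriticalPhenomena.PercolationContinuityZ3.Theorems
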